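import Mathlib
import HarnessLib
import Summits.NavierStokesRegularity.NavierStokesRegularity.Theorems.UnthreadedDoorNetFluxEnvelopeRegularity

/-!
# Route `UnthreadedDoor`, crux `PoloidalLiouville` (stmt-NavierStokesRegularity-1222), WALL W1 `stub_scalarLiouville` —
# crux idea «netflux-typei-gap» (ns-idea-14), stub NF-1b `SupEnvelopeLaw`: LOWER SEMICONTINUITY OF INFIMA OVER THE SPHERICAL
# ARGMAX (the measurability of `supEnvDefect`) — session 1 of the multi-session build, file 3

KEY-NS #156.  Berge's lemma for the spherical argmax correspondence: for `T` jointly continuous off the centre, the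
correspondence `(t,r) ↦ argmax_{S_r(x₀)} T(t)` is upper hemicontinuous with nonempty compact values (limits of maximisers on
converging spheres are maximisers), hence for every `d` jointly continuous off the centre the marginal function
`(t,r) ↦ inf { d((t,r), x) : x ∈ argmax_{S_r(x₀)} T(t) }` is LOWER SEMICONTINUOUS on `]t₀,0[ × ]0,∞[` (so Borel measurable on
that open set).  With `d = ∂ₜT − ∂_r²T − (2/r)∂_rT` this is the measurability / lower semicontinuity of `supEnvDefect`, the
right-hand side of NF-1b.  Proof by sequences: if `D(pₙ) ≤ y` along `pₙ → p`, minimisers `xₙ ∈ argmax(pₙ)` have a convergent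
subsequence (bounded, `tendsto_subseq_of_frequently_bounded`), the limit is a maximiser at `p` (compare with the radially
rescaled competitors `x₀ + (rₙ/r)(y − x₀)`), and continuity of `d` gives `D(p) ≤ d(p, x*) ≤ y`.

* `lowerSemicontinuousOn_sInf_sphArgmax` — the abstract Berge lemma for `sInf (d p '' argmax_{S_{p.2}(x₀)} T(p.1))`;
* `lowerSemicontinuousOn_supEnvDefect_of_continuousOn` — the case of `supEnvDefect`, given joint continuity of its defect
  integrand off the centre;
* `contDiffOn_fderiv_xslice`, `contDiffOn_deriv_tslice` — slice derivatives of a function smooth on an open set of `ℝ × ℝ³`;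
* `radDeriv_eq_fderiv`, `radDeriv2_eq_fderiv_fderiv` — the radial derivatives as directional derivatives along
  `u(x) = (x − x₀)/‖x − x₀‖`; `continuousOn_supEnvDefect_integrand` — the defect integrand of a jointly smooth `T` is jointly
  continuous off the centre; `lowerSemicontinuousOn_supEnvDefect` — hence `supEnvDefect` is lsc for smooth `T`.

WHAT THIS IS NOT: no NS-regularity statement is touched; NF-1b is NOT proved here; `PoloidalLiouville` (1222), W1, the line's rung
target and the summit stay OPEN.  `--supports stmt-NavierStokesRegularity-1222 --as helper`.  [folklore]
-/

noncomputable section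

-- the summit and its single sub-problem share the name (CONVENTIONS §1)
set_option linter.dupNamespace false

open Set Function Filter Topology InnerProductSpace MeasureTheory
open scoped RealInnerProductSpace ContDiff

namespace Summit.NavierStokesRegularity.NavierStokesRegularity.Theorems.PoloidalLiouville.NetFlux

open Literature.Analysis Literature.Analysis.FluidPDE

variable {T : ℝ → E3 → ℝ} {x₀ : E3} {t₀ : ℝ}

/-- **Berge's lemma for the spherical argmax (lower semicontinuity of marginal infima).**  Let `T` be jointly continuous on
`]t₀,0[ × (ℝ³ ∖ {x₀})` and `d : (ℝ × ℝ) → ℝ³ → ℝ` jointly continuous on `(]t₀,0[ × ]0,∞[) × (ℝ³ ∖ {x₀})`.  Then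
`p = (t,r) ↦ inf { d(p, x) : x ∈ argmax_{S_r(x₀)} T(t) }` is lower semicontinuous on `]t₀,0[ × ]0,∞[`. [folklore] -/
theorem lowerSemicontinuousOn_sInf_sphArgmax {d : ℝ × ℝ → E3 → ℝ}
    (hT : ContinuousOn (uncurry T) (Ioo t₀ 0 ×ˢ ({x₀}ᶜ : Set E3)))
    (hd : ContinuousOn (uncurry d) ((Ioo t₀ 0 ×ˢ Ioi (0 : ℝ)) ×ˢ ({x₀}ᶜ : Set E3))) :
    LowerSemicontinuousOn (fun p : ℝ × ℝ => sInf (d p '' sphArgmax (T p.1) x₀ p.2)) (Ioo t₀ 0 ×ˢ Ioi 0) := by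
  set Q : Set (ℝ × ℝ) := Ioo t₀ 0 ×ˢ Ioi 0 with hQ_def
  have hQo : IsOpen Q := isOpen_Ioo.prod isOpen_Ioi
  have hUo : IsOpen (Q ×ˢ ({x₀}ᶜ : Set E3)) := hQo.prod isOpen_compl_singleton
  have hVo : IsOpen (Ioo t₀ 0 ×ˢ ({x₀}ᶜ : Set E3)) := isOpen_Ioo.prod isOpen_compl_singleton
  -- attainment at every point of `Q`
  have hatt : ∀ q ∈ Q, (∃ x ∈ sphArgmax (T q.1) x₀ q.2, sInf (d q '' sphArgmax (T q.1) x₀ q.2) = d q x) ∧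
      (∀ x ∈ sphArgmax (T q.1) x₀ q.2, sInf (d q '' sphArgmax (T q.1) x₀ q.2) ≤ d q x) ∧
      BddBelow (d q '' sphArgmax (T q.1) x₀ q.2) := fun q hq =>
    exists_mem_sphArgmax_sInf_eq hq.2 (continuousOn_slice_compl hT hq.1)
      (hd.comp (Continuous.prodMk_right q).continuousOn fun _ hx => ⟨hq, hx⟩)
  intro p hp y hy
  by_contra hcon
  -- a sequence `pₙ → p` in `Q` with `D(pₙ) ≤ y`
  have hfreq : ∃ᶠ q in 𝓝[Q] p, sInf (d q '' sphArgmax (T q.1) x₀ q.2) ≤ y ∧ q ∈ Q := by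
    have h1 : ∃ᶠ q in 𝓝[Q] p, sInf (d q '' sphArgmax (T q.1) x₀ q.2) ≤ y := by
      rw [Filter.not_eventually] at hcon
      exact hcon.mono fun q hq => not_lt.1 hq
    exact h1.and_eventually eventually_mem_nhdsWithin
  obtain ⟨ps, hps, hps'⟩ := Filter.exists_seq_forall_of_frequently hfreq
  have hpsQ : ∀ n, ps n ∈ Q := fun n => (hps' n).2
  have hle : ∀ n, sInf (d (ps n) '' sphArgmax (T (ps n).1) x₀ (ps n).2) ≤ y := fun n => (hps' n).1
  have hlim : Tendsto ps atTop (𝓝 p) := tendsto_nhds_of_tendsto_nhdsWithin hps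
  -- minimisers
  choose xs hxsA hxs using fun n => (hatt (ps n) (hpsQ n)).1
  have hxsS : ∀ n, ‖xs n - x₀‖ = (ps n).2 := fun n => by
    have h := (hxsA n).1
    rwa [mem_sphere_iff_norm] at h
  -- the minimisers are eventually in a fixed closed ball: extract a convergent subsequence
  have hr2 : Tendsto (fun n => (ps n).2) atTop (𝓝 p.2) := (continuous_snd.tendsto p).comp hlim
  have hr1 : Tendsto (fun n => (ps n).1) atTop (𝓝 p.1) := (continuous_fst.tendsto p).comp hlim
  have hball : ∃ᶠ n in atTop, xs n ∈ Metric.closedBall x₀ (p.2 + 1) := by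
    refine Filter.Eventually.frequently ?_
    filter_upwards [hr2.eventually (gt_mem_nhds (lt_add_one p.2))] with n hn
    rw [Metric.mem_closedBall, dist_eq_norm, hxsS n]
    exact hn.le
  obtain ⟨xstar, -, φ, hφ, hconv⟩ := tendsto_subseq_of_frequently_bounded Metric.isBounded_closedBall hball
  have hφt : Tendsto φ atTop atTop := hφ.tendsto_atTop
  -- (i) the limit lies on the sphere of radius `p.2`
  have hnorm : ‖xstar - x₀‖ = p.2 := by
    have h1 : Tendsto (fun n => ‖xs (φ n) - x₀‖) atTop (𝓝 ‖xstar - x₀‖) :=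
      ((continuous_id.sub continuous_const).norm.tendsto xstar).comp hconv
    have h2 : Tendsto (fun n => ‖xs (φ n) - x₀‖) atTop (𝓝 p.2) := by
      have : (fun n => ‖xs (φ n) - x₀‖) = fun n => (ps (φ n)).2 := funext fun n => hxsS (φ n)
      rw [this]; exact hr2.comp hφt
    exact tendsto_nhds_unique h1 h2
  have hstar0 : xstar ≠ x₀ := fun h => by
    rw [h, sub_self, norm_zero] at hnorm
    exact (show (0 : ℝ) < p.2 from hp.2).ne hnorm
  -- (ii) the limit is a maximiser at `p`
  have hTc : ∀ z : E3, z ≠ x₀ → ContinuousAt (uncurry T) (p.1, z) := fun z hz =>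
    hT.continuousAt (hVo.mem_nhds ⟨hp.1, hz⟩)
  have hmax : xstar ∈ sphArgmax (T p.1) x₀ p.2 := by
    refine ⟨mem_sphere_iff_norm.2 hnorm, fun y' hy' => ?_⟩
    rw [mem_sphere_iff_norm] at hy'
    have hy'0 : y' ≠ x₀ := fun h => by
      rw [h, sub_self, norm_zero] at hy'
      exact (show (0 : ℝ) < p.2 from hp.2).ne hy'
    -- competitors on the approximating spheres
    set ys : ℕ → E3 := fun n => x₀ + ((ps (φ n)).2 * p.2⁻¹) • (y' - x₀) with hys
    have hysS : ∀ n, ys n ∈ Metric.sphere x₀ (ps (φ n)).2 := fun n => by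
      rw [mem_sphere_iff_norm, hys]
      simp only [add_sub_cancel_left, norm_smul, Real.norm_eq_abs]
      rw [abs_of_pos (mul_pos (hpsQ (φ n)).2 (inv_pos.2 hp.2)), hy', mul_assoc, inv_mul_cancel₀ (ne_of_gt hp.2), mul_one]
    have hcomp : ∀ n, T (ps (φ n)).1 (ys n) ≤ T (ps (φ n)).1 (xs (φ n)) := fun n => (hxsA (φ n)).2 _ (hysS n)
    -- limits of both sides
    have hys_lim : Tendsto ys atTop (𝓝 y') := by
      have h : Tendsto (fun n => x₀ + ((ps (φ n)).2 * p.2⁻¹) • (y' - x₀)) atTop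
          (𝓝 (x₀ + (p.2 * p.2⁻¹) • (y' - x₀))) :=
        tendsto_const_nhds.add (((hr2.comp hφt).mul tendsto_const_nhds).smul tendsto_const_nhds)
      rwa [mul_inv_cancel₀ (ne_of_gt hp.2), one_smul, add_sub_cancel] at h
    have hL : Tendsto (fun n => T (ps (φ n)).1 (ys n)) atTop (𝓝 (T p.1 y')) := by
      have h := (hTc y' hy'0).tendsto.comp ((hr1.comp hφt).prodMk_nhds hys_lim)
      exact h
    have hR : Tendsto (fun n => T (ps (φ n)).1 (xs (φ n))) atTop (𝓝 (T p.1 xstar)) := by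
      have h := (hTc xstar hstar0).tendsto.comp ((hr1.comp hφt).prodMk_nhds hconv)
      exact h
    exact le_of_tendsto_of_tendsto' hL hR hcomp
  -- (iii) the defect at the limit is at most `y`
  have hdc : ContinuousAt (uncurry d) (p, xstar) := hd.continuousAt (hUo.mem_nhds ⟨hp, hstar0⟩)
  have hdlim : Tendsto (fun n => d (ps (φ n)) (xs (φ n))) atTop (𝓝 (d p xstar)) := by
    have h := hdc.tendsto.comp ((hlim.comp hφt).prodMk_nhds hconv)
    exact h
  have hdy : d p xstar ≤ y :=
    le_of_tendsto' hdlim fun n => by rw [← hxs (φ n)]; exact hle (φ n)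
  -- (iv) contradiction with `y < D(p) ≤ d(p, x*)`
  have hDle : sInf (d p '' sphArgmax (T p.1) x₀ p.2) ≤ d p xstar := (hatt p hp).2.1 xstar hmax
  exact absurd (hy.trans_le (hDle.trans hdy)) (lt_irrefl y)

/-- **Lower semicontinuity of the envelope defect** `supEnvDefect T x₀` on `]t₀,0[ × ]0,∞[`, given joint continuity of `T` and of
the defect integrand `((t,r), x) ↦ ∂ₜT(t,x) − ∂_r²T(t,x) − (2/r)∂_rT(t,x)` off the centre (the latter follows from joint `C²`
smoothness of `T`; supplied by the caller). [folklore] -/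
theorem lowerSemicontinuousOn_supEnvDefect_of_continuousOn
    (hT : ContinuousOn (uncurry T) (Ioo t₀ 0 ×ˢ ({x₀}ᶜ : Set E3)))
    (hd : ContinuousOn (fun q : (ℝ × ℝ) × E3 =>
      deriv (fun s => T s q.2) q.1.1 - radDeriv2 (T q.1.1) x₀ q.2 - (2 / q.1.2) * radDeriv (T q.1.1) x₀ q.2)
      ((Ioo t₀ 0 ×ˢ Ioi (0 : ℝ)) ×ˢ ({x₀}ᶜ : Set E3))) :
    LowerSemicontinuousOn (fun p : ℝ × ℝ => supEnvDefect T x₀ p.1 p.2) (Ioo t₀ 0 ×ˢ Ioi 0) :=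
  lowerSemicontinuousOn_sInf_sphArgmax
    (d := fun p x => deriv (fun s => T s x) p.1 - radDeriv2 (T p.1) x₀ x - (2 / p.2) * radDeriv (T p.1) x₀ x) hT hd

/-! ### The defect integrand of a jointly smooth `T` is jointly continuous off the centre -/

section SliceCalculus

variable {F' : Type*} [NormedAddCommGroup F'] [NormedSpace ℝ F']

/-- **Spatial slice derivatives of a function smooth on an open set of `ℝ × ℝ³`**: for `f` smooth on the open `W`, the map
`(t,x) ↦ D(f(t,·))(x)` is smooth on `W` and equals `Df(t,x) ∘ (0, ·)` there. [folklore] -/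
theorem contDiffOn_fderiv_xslice {W : Set (ℝ × E3)} (hW : IsOpen W) {f : ℝ × E3 → F'} (hf : ContDiffOn ℝ (⊤ : ℕ∞) f W) :
    (∀ q ∈ W, fderiv ℝ (fun y => f (q.1, y)) q.2 = (fderiv ℝ f q).comp (ContinuousLinearMap.inr ℝ ℝ E3)) ∧
    ContDiffOn ℝ (⊤ : ℕ∞) (fun q : ℝ × E3 => fderiv ℝ (fun y => f (q.1, y)) q.2) W := by
  have heq : ∀ q ∈ W, fderiv ℝ (fun y => f (q.1, y)) q.2 = (fderiv ℝ f q).comp (ContinuousLinearMap.inr ℝ ℝ E3) := by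
    intro q hq
    have hfd : DifferentiableAt ℝ f (q.1, q.2) := (hf.differentiableOn (by simp) q hq).differentiableAt (hW.mem_nhds hq)
    have e : (fun y => f (q.1, y)) = f ∘ fun y => (q.1, y) := rfl
    rw [e, fderiv_comp q.2 hfd ((differentiableAt_const q.1).prodMk differentiableAt_id),
      (hasFDerivAt_prodMk_right q.1 q.2).fderiv]
  refine ⟨heq, ?_⟩
  have h : ContDiffOn ℝ (⊤ : ℕ∞) (fun q : ℝ × E3 => (fderiv ℝ f q).comp (ContinuousLinearMap.inr ℝ ℝ E3)) W :=
    (hf.fderiv_of_isOpen hW (by simp)).clm_comp contDiffOn_const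
  exact h.congr heq

/-- **Time slice derivative of a function smooth on an open set of `ℝ × ℝ³`**: `∂ₜ f(t,x) = Df(t,x)(1,0)` on `W`, and it is smooth
there. [folklore] -/
theorem contDiffOn_deriv_tslice {W : Set (ℝ × E3)} (hW : IsOpen W) {f : ℝ × E3 → F'} (hf : ContDiffOn ℝ (⊤ : ℕ∞) f W) :
    (∀ q ∈ W, deriv (fun s => f (s, q.2)) q.1 = fderiv ℝ f q ((1 : ℝ), (0 : E3))) ∧
    ContDiffOn ℝ (⊤ : ℕ∞) (fun q : ℝ × E3 => deriv (fun s => f (s, q.2)) q.1) W := by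
  have heq : ∀ q ∈ W, deriv (fun s => f (s, q.2)) q.1 = fderiv ℝ f q ((1 : ℝ), (0 : E3)) := by
    intro q hq
    have hfd : DifferentiableAt ℝ f (q.1, q.2) := (hf.differentiableOn (by simp) q hq).differentiableAt (hW.mem_nhds hq)
    have h1 : HasDerivAt (fun s : ℝ => ((s, q.2) : ℝ × E3)) ((1 : ℝ), (0 : E3)) q.1 :=
      (hasDerivAt_id q.1).prodMk (hasDerivAt_const q.1 q.2)
    exact (hfd.hasFDerivAt.comp_hasDerivAt q.1 h1).deriv
  refine ⟨heq, ?_⟩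
  have h : ContDiffOn ℝ (⊤ : ℕ∞) (fun q : ℝ × E3 => fderiv ℝ f q ((1 : ℝ), (0 : E3))) W :=
    (hf.fderiv_of_isOpen hW (by simp)).clm_apply contDiffOn_const
  exact h.congr heq

end SliceCalculus

/-- The unit radial vector `u(x) = (x − x₀)/‖x − x₀‖` is continuous off the centre. [folklore] -/
theorem continuousOn_radialUnit (x₀ : E3) :
    ContinuousOn (fun x : E3 => ‖x - x₀‖⁻¹ • (x - x₀)) ({x₀}ᶜ) := by
  refine ContinuousOn.smul (ContinuousOn.inv₀ (continuous_id.sub continuous_const).norm.continuousOn fun x hx => ?_)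
    (continuous_id.sub continuous_const).continuousOn
  exact norm_ne_zero_iff.2 (sub_ne_zero.2 hx)

/-- `x₀ + ‖x − x₀‖ · u(x) = x` for the unit radial vector `u(x)`, `x ≠ x₀`. [folklore] -/
theorem center_add_norm_smul_radialUnit {x₀ x : E3} (hx : x ≠ x₀) :
    x₀ + ‖x - x₀‖ • (‖x - x₀‖⁻¹ • (x - x₀)) = x := by
  rw [smul_smul, mul_inv_cancel₀ (norm_ne_zero_iff.2 (sub_ne_zero.2 hx)), one_smul, add_sub_cancel]

/-- **The radial derivative is the directional derivative along the unit radial vector**: for `f` differentiable at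
`x ≠ x₀`, `radDeriv f x₀ x = Df(x)[u(x)]`. [folklore] -/
theorem radDeriv_eq_fderiv {f : E3 → ℝ} {x₀ x : E3} (hx : x ≠ x₀) (hf : DifferentiableAt ℝ f x) :
    radDeriv f x₀ x = fderiv ℝ f x (‖x - x₀‖⁻¹ • (x - x₀)) := by
  unfold radDeriv
  have hf' : DifferentiableAt ℝ f (x₀ + ‖x - x₀‖ • (‖x - x₀‖⁻¹ • (x - x₀))) := by
    rwa [center_add_norm_smul_radialUnit hx]
  have h := hasDerivAt_radial (x₀ := x₀) (ξ := ‖x - x₀‖⁻¹ • (x - x₀)) hf'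
  rw [center_add_norm_smul_radialUnit hx] at h
  exact h.deriv

/-- **The second radial derivative is the second directional derivative along the unit radial vector**: for `f` smooth off
`x₀` and `x ≠ x₀`, `radDeriv2 f x₀ x = D²f(x)[u(x), u(x)]`. [folklore] -/
theorem radDeriv2_eq_fderiv_fderiv {f : E3 → ℝ} {x₀ x : E3} (hx : x ≠ x₀) (hf : ContDiffOn ℝ (⊤ : ℕ∞) f ({x₀}ᶜ)) :
    radDeriv2 f x₀ x = fderiv ℝ (fderiv ℝ f) x (‖x - x₀‖⁻¹ • (x - x₀)) (‖x - x₀‖⁻¹ • (x - x₀)) := by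
  have hO : IsOpen ({x₀}ᶜ : Set E3) := isOpen_compl_singleton
  unfold radDeriv2
  set u : E3 := ‖x - x₀‖⁻¹ • (x - x₀) with hu
  have hρ₀ : 0 < ‖x - x₀‖ := norm_pos_iff.2 (sub_ne_zero.2 hx)
  have hu1 : ‖u‖ = 1 := by rw [hu, norm_smul, norm_inv, norm_norm, inv_mul_cancel₀ hρ₀.ne']
  have hxu : x₀ + ‖x - x₀‖ • u = x := by rw [hu]; exact center_add_norm_smul_radialUnit hx
  have hne : ∀ ρ : ℝ, 0 < ρ → x₀ + ρ • u ≠ x₀ := fun ρ hρ => center_add_smul_ne hρ (mem_sphere_zero_iff_norm.2 hu1)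
  have hfd : ∀ y : E3, y ≠ x₀ → DifferentiableAt ℝ f y := fun y hy =>
    (hf.differentiableOn (by simp) y hy).differentiableAt (hO.mem_nhds hy)
  have hf2 : ContDiffOn ℝ (⊤ : ℕ∞) (fderiv ℝ f) ({x₀}ᶜ) := hf.fderiv_of_isOpen hO (by simp)
  have hf2d : ∀ y : E3, y ≠ x₀ → DifferentiableAt ℝ (fderiv ℝ f) y := fun y hy =>
    (hf2.differentiableOn (by simp) y hy).differentiableAt (hO.mem_nhds hy)
  -- the first ray derivative near `ρ₀ = ‖x − x₀‖`
  have hd1 : ∀ ρ : ℝ, 0 < ρ → HasDerivAt (fun ρ : ℝ => f (x₀ + ρ • u)) (fderiv ℝ f (x₀ + ρ • u) u) ρ := fun ρ hρ =>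
    hasDerivAt_radial (hfd _ (hne ρ hρ))
  have hev : deriv (fun ρ : ℝ => f (x₀ + ρ • u)) =ᶠ[𝓝 ‖x - x₀‖] fun ρ => fderiv ℝ f (x₀ + ρ • u) u := by
    filter_upwards [Ioi_mem_nhds hρ₀] with ρ hρ
    exact (hd1 ρ hρ).deriv
  -- the second ray derivative at `ρ₀`
  have hF : DifferentiableAt ℝ (fun y => fderiv ℝ f y u) (x₀ + ‖x - x₀‖ • u) := by
    rw [hxu]
    exact (hf2d x hx).clm_apply (differentiableAt_const u)
  have hd2 := hasDerivAt_radial (x₀ := x₀) (ξ := u) hF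
  rw [hxu, fderiv_clm_apply (hf2d x hx) (differentiableAt_const u)] at hd2
  have e2 : iteratedDeriv 2 (fun ρ : ℝ => f (x₀ + ρ • u)) = deriv (deriv fun ρ : ℝ => f (x₀ + ρ • u)) := by
    rw [show (2 : ℕ) = 1 + 1 from rfl, iteratedDeriv_succ, iteratedDeriv_one]
  rw [e2, hev.deriv_eq, hd2.deriv]
  simp only [_root_.add_apply, ContinuousLinearMap.comp_apply, ContinuousLinearMap.flip_apply,
    fderiv_fun_const, Pi.zero_apply, _root_.zero_apply, map_zero, zero_add]

/-- **The defect integrand of a jointly smooth `T` is jointly continuous off the centre**: `((t,r),x) ↦ ∂ₜT(t,x) − ∂_r²T(t,x) −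
(2/r) ∂_rT(t,x)` (with the radial derivatives `radDeriv`, `radDeriv2` about `x₀`) is continuous on `(]t₀,0[ × ]0,∞[) × (ℝ³ ∖ {x₀})`
for `T` smooth on `]t₀,0[ × (ℝ³ ∖ {x₀})`. [folklore] -/
theorem continuousOn_supEnvDefect_integrand (hT : ContDiffOn ℝ (⊤ : ℕ∞) (uncurry T) (Ioo t₀ 0 ×ˢ ({x₀}ᶜ : Set E3))) :
    ContinuousOn (fun q : (ℝ × ℝ) × E3 =>
      deriv (fun s => T s q.2) q.1.1 - radDeriv2 (T q.1.1) x₀ q.2 - (2 / q.1.2) * radDeriv (T q.1.1) x₀ q.2)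
      ((Ioo t₀ 0 ×ˢ Ioi (0 : ℝ)) ×ˢ ({x₀}ᶜ : Set E3)) := by
  set W : Set (ℝ × E3) := Ioo t₀ 0 ×ˢ ({x₀}ᶜ : Set E3) with hW
  have hWo : IsOpen W := isOpen_Ioo.prod isOpen_compl_singleton
  -- slice derivatives of `uncurry T` on `W`
  obtain ⟨hteq, htC⟩ := contDiffOn_deriv_tslice hWo hT
  obtain ⟨-, hx1C⟩ := contDiffOn_fderiv_xslice hWo hT
  have hx1C' : ContDiffOn ℝ (⊤ : ℕ∞) (fun q : ℝ × E3 => fderiv ℝ (T q.1) q.2) W := hx1C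
  obtain ⟨-, hx2C⟩ := contDiffOn_fderiv_xslice hWo hx1C'
  have hx2C' : ContDiffOn ℝ (⊤ : ℕ∞) (fun q : ℝ × E3 => fderiv ℝ (fderiv ℝ (T q.1)) q.2) W := hx2C
  -- the projection `((t,r),x) ↦ (t,x)` and the coefficient `2/r`
  set π : (ℝ × ℝ) × E3 → ℝ × E3 := fun q => (q.1.1, q.2) with hπ
  have hπc : Continuous π := (continuous_fst.comp continuous_fst).prodMk continuous_snd
  have hπm : MapsTo π ((Ioo t₀ 0 ×ˢ Ioi (0 : ℝ)) ×ˢ ({x₀}ᶜ : Set E3)) W := fun q hq => ⟨hq.1.1, hq.2⟩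
  have hu : ContinuousOn (fun q : (ℝ × ℝ) × E3 => ‖q.2 - x₀‖⁻¹ • (q.2 - x₀)) ((Ioo t₀ 0 ×ˢ Ioi (0 : ℝ)) ×ˢ ({x₀}ᶜ : Set E3)) :=
    (continuousOn_radialUnit x₀).comp continuous_snd.continuousOn fun q hq => hq.2
  have hA : ContinuousOn (fun q : (ℝ × ℝ) × E3 => deriv (fun s => T s q.2) q.1.1)
      ((Ioo t₀ 0 ×ˢ Ioi (0 : ℝ)) ×ˢ ({x₀}ᶜ : Set E3)) := htC.continuousOn.comp hπc.continuousOn hπm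
  have hB : ContinuousOn (fun q : (ℝ × ℝ) × E3 =>
      fderiv ℝ (fderiv ℝ (T q.1.1)) q.2 (‖q.2 - x₀‖⁻¹ • (q.2 - x₀)) (‖q.2 - x₀‖⁻¹ • (q.2 - x₀)))
      ((Ioo t₀ 0 ×ˢ Ioi (0 : ℝ)) ×ˢ ({x₀}ᶜ : Set E3)) :=
    ((hx2C'.continuousOn.comp hπc.continuousOn hπm).clm_apply hu).clm_apply hu
  have hC : ContinuousOn (fun q : (ℝ × ℝ) × E3 =>
      (2 / q.1.2) * fderiv ℝ (T q.1.1) q.2 (‖q.2 - x₀‖⁻¹ • (q.2 - x₀)))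
      ((Ioo t₀ 0 ×ˢ Ioi (0 : ℝ)) ×ˢ ({x₀}ᶜ : Set E3)) := by
    refine ContinuousOn.mul ?_ ((hx1C'.continuousOn.comp hπc.continuousOn hπm).clm_apply hu)
    exact continuousOn_const.div (continuous_snd.comp continuous_fst).continuousOn fun q hq => (show 0 < q.1.2 from hq.1.2).ne'
  refine ((hA.sub hB).sub hC).congr fun q hq => ?_
  have hx : q.2 ≠ x₀ := hq.2
  have hslice : ContDiffOn ℝ (⊤ : ℕ∞) (T q.1.1) ({x₀}ᶜ) :=
    hT.comp (contDiff_prodMk_right q.1.1).contDiffOn fun _ hy => ⟨hq.1.1, hy⟩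
  have hdiff : DifferentiableAt ℝ (T q.1.1) q.2 :=
    (hslice.differentiableOn (by simp) _ hx).differentiableAt (isOpen_compl_singleton.mem_nhds hx)
  simp only [Pi.sub_apply]
  rw [radDeriv_eq_fderiv hx hdiff, radDeriv2_eq_fderiv_fderiv hx hslice]

/-- **Lower semicontinuity (hence Borel measurability) of the envelope defect** `supEnvDefect T x₀` on `]t₀,0[ × ]0,∞[` for `T`
jointly smooth on `]t₀,0[ × (ℝ³ ∖ {x₀})`. [folklore] -/
theorem lowerSemicontinuousOn_supEnvDefect (hT : ContDiffOn ℝ (⊤ : ℕ∞) (uncurry T) (Ioo t₀ 0 ×ˢ ({x₀}ᶜ : Set E3))) :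
    LowerSemicontinuousOn (fun p : ℝ × ℝ => supEnvDefect T x₀ p.1 p.2) (Ioo t₀ 0 ×ˢ Ioi 0) :=
  lowerSemicontinuousOn_supEnvDefect_of_continuousOn hT.continuousOn (continuousOn_supEnvDefect_integrand hT)

end Summit.NavierStokesRegularity.NavierStokesRegularity.Theorems.PoloidalLiouville.NetFlux

end
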